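import Mathlib
import Summits.Ventures.HodgeRepro2.Tier7.Line3.CongruenceSubgroup
import Summits.Ventures.HodgeRepro2.Tier7.Line3.TorusSupport
import Summits.Ventures.HodgeRepro2.Tier7.Line3.LevelFactorData

/-!
# Tier7/Line3/JointSupport — ONE `arith` for the κ-fields and the `b`-fields at the level place
(seat t7-x1, gen 3; STAGE 3 of the joint `arith` — crit-2's record (a) on LevelFactorData p693194, STATUS l. 15678)

LINE 3 (t7-plan-3), version (ii). With the level tower `K N = K_{q⁻¹ ^ (N+1)}` (CongruenceSubgroup) and p1's tori as
groups (TorusSupport), the level-`N` support of `LevelFactorData`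
`arith N γ := arithS γ ∧ InSupport (iotaA σ) (iotaB σ f) (loc γ₀) (K N) (loc γ)`
IMPLIES L1-p5's `hsupp` clause of `KappaDataFinLocal.hcong_field_local` at `v₁`:
`∃ k, IsTranslate σ f (loc γ) (loc γ₀ · k) ∧ ∀ i j, abv ((k − 1) i j) ≤ q⁻¹ ^ N`
(`hsupp_of_inSupport_levelTower`; the radius `q⁻¹ ^ (N+1) ≤ q⁻¹ ^ N`). Hence a `LevelFactorData` built on these tori
and this tower (`hsupp_of_arith`) feeds BOTH packagings from ONE predicate: its `b`-fields (`kappaData_b_fields`, at `v₁`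
by theorems) and, through `hcong_field_local`, the κ-congruence `hcong` of `FinKappa` — the κ-side and the finite-factor
side of `KappaData` meet at one `arith`, at the model. DICTIONARY (in words): `F = E_{v₁}`, `loc γ = (matO γ).map ψ` as a
unit of `GL₂`, `T_B ⊂ GL₂(𝓞_{v₁})` for the normalisation of the tower, `f` the local second basis. Nothing here is about
(N), (P), the real `X`, or HC_CM; §8(d): NO. Blind lane: Mathlib + the HodgeRepro2 prefix; no sorry;
axioms ⊆ {propext, Classical.choice, Quot.sound}.
-/

namespace Summit.Ventures.HodgeRepro2.Tier7.Line3.JointSupport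

open Matrix Summit.Ventures.HodgeRepro2.Tier7.Line3.KappaDataFinLocal
  Summit.Ventures.HodgeRepro2.Tier7.Line3.LevelInvariantOrbital
  Summit.Ventures.HodgeRepro2.Tier7.Line3.CongruenceSubgroup
  Summit.Ventures.HodgeRepro2.Tier7.Line3.TorusSupport
  Summit.Ventures.HodgeRepro2.Tier7.Line3.LevelFactor

variable {F : Type*} [Field F] (σ : F →+* F) (f : Fin 2 → Fin 2 → F) (abv : AbsoluteValue F ℝ)
  (hna : IsNonarchimedean abv) {q : ℝ}

/-- the radius of level `N + 1` is at most `q⁻¹ ^ N`. -/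
theorem radius_le (hq : 1 < q) (N : ℕ) : q⁻¹ ^ (N + 1) ≤ q⁻¹ ^ N :=
  pow_le_pow_of_le_one (inv_nonneg.2 (zero_le_one.trans hq.le)) (inv_le_one_of_one_le₀ hq.le) (Nat.le_succ N)

/-- **the support in the group gives p5's `hsupp` clause**: `γ ∈ ι_A(A) γ₀ K_N ι_B(B)` (level tower) implies
`∃ k, IsTranslate σ f γ (γ₀ · k) ∧ ∀ i j, abv ((k − 1) i j) ≤ q⁻¹ ^ N`. -/
theorem hsupp_of_inSupport_levelTower (hq : 1 < q) (N : ℕ) (γ₀ γ : GL (Fin 2) F)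
    (h : InSupport (iotaA σ) (iotaB σ f) γ₀ (levelTower abv hna hq N) γ) :
    ∃ k : Matrix (Fin 2) (Fin 2) F,
      IsTranslate σ f (γ : Matrix (Fin 2) (Fin 2) F) ((γ₀ : Matrix (Fin 2) (Fin 2) F) * k) ∧
        ∀ i j, abv ((k - 1) i j) ≤ q⁻¹ ^ N := by
  obtain ⟨k, hk, ht⟩ := isTranslate_of_inSupport σ f _ γ₀ γ h
  refine ⟨(k : Matrix (Fin 2) (Fin 2) F), by rwa [Units.val_mul] at ht, fun i j => ?_⟩
  exact ((show EntryLE abv (q⁻¹ ^ (N + 1)) ((k : Matrix (Fin 2) (Fin 2) F) - 1) from hk) i j).trans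
    (radius_le hq N)

/-- **ONE `arith` for both packagings**: for a `LevelFactorData` on p1's tori and the level tower, its support
predicate `arith` gives p5's `hsupp` clause at every level — the hypothesis of `KappaDataFinLocal.hcong_field_local`
(the κ-side) — while its `b`-fields hold by `LevelFactorData.kappaData_b_fields` (the finite-factor side). -/
theorem hsupp_of_arith (hq : 1 < q) {Orb : Type*} [MeasurableSpace (torusA σ)] [MeasurableSpace (torusB σ f)]
    {μA : MeasureTheory.Measure (torusA σ)} {μB : MeasureTheory.Measure (torusB σ f)}
    (D : LevelFactorData (torusA σ) (torusB σ f) (GL (Fin 2) F) Orb μA μB) (hA : D.ιA = iotaA σ)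
    (hB : D.ιB = iotaB σ f) (hK : D.K = levelTower abv hna hq) :
    ∀ N γ, D.arith N γ →
      ∃ k : Matrix (Fin 2) (Fin 2) F,
        IsTranslate σ f ((D.loc γ : GL (Fin 2) F) : Matrix (Fin 2) (Fin 2) F)
            (((D.loc D.γ₀ : GL (Fin 2) F) : Matrix (Fin 2) (Fin 2) F) * k) ∧
          ∀ i j, abv ((k - 1) i j) ≤ q⁻¹ ^ N := by
  intro N γ hγ
  have h2 := hγ.2
  rw [hA, hB, hK] at h2
  exact hsupp_of_inSupport_levelTower σ f abv hna hq N (D.loc D.γ₀) (D.loc γ) h2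

end Summit.Ventures.HodgeRepro2.Tier7.Line3.JointSupport
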